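import Summits.BirchSwinnertonDyer.BirchSwinnertonDyer.Theorems.ResidualThetaTransportAtTwoThetaLayerLambdaCongruenceAtTwoHeckeAdjointReexpansion
import HarnessLib

/-!
# Crux `ThetaLayerLambdaCongruenceAtTwo` (stmt-BirchSwinnertonDyer-20688, route ResidualThetaTransportAtTwo), line
# `birth` v14 — SD floor, kernel road, Hecke clause of IP, brick HA7 «MANIN CHAINS OF THE COCYCLE»: for an upper-triangular Hecke
# representative `M` with `Mγ' = δM'`, the concatenated re-expansions of the generalised edges `M·g·S` (`g` running over a Manin chain
# of `γ'`) form a Manin chain of `δ` (width seat bsd-wall-rtt-p3-w3 g11; `--supports stmt-BirchSwinnertonDyer-20688 --as helper`; closes nothing)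

HONEST FRAMING. Elementary THEOREMS about lists in `SL₂(ℤ)` and cusp functions; no definition; nothing about any curve or form is asserted;
BSD is not proved by any of this.

WHAT (memo `Cruxes/ThetaLayerLambdaCongruenceAtTwo/Lines/birth-sd2-hecke-adjoint.md`, step (D)). A cusp function (`F(gT) = F(g)`,
`F(−g) = F(g)`) only depends on the cusp `g∞`, i.e. on the first column up to sign: `cuspFn_eq_of_col_smul_eq` (proportional first columns ⇒
equal values; primitive vectors). For `M, M'` upper triangular of positive determinant with `M·γ' = δ·M'` (`δ ∈ Γ₀(N)`), a Manin chain `L`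
of `γ'` (`Σ_{g∈L} F(g) − F(gS) = F(γ') − F(1)`) and, for every `g`, re-expansion data of the generalised edge `M·g·S` as delivered by
`exists_reexpansion` (lists `P_g`, frames `g₀(g)`, `h₁(g)`): the list `L' = concat_g [g₀(g)·f·S : f ∈ P_g]` is a Manin chain of `δ`
(`maninChain_of_reexpansions`). This is the Manin-slot input of the transpose identity (brick HA8).

References: [Manin1972] §1.5–1.7; [Merel1995Homologie] §2.1 (condition (C)); [CremonaAlgorithms1997] §2.2.
-/

set_option autoImplicit false

noncomputable section

-- justification: the `Summit.BirchSwinnertonDyer.BirchSwinnertonDyer.…` path repeats a component (route-file convention)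
set_option linter.dupNamespace false

open scoped Classical MatrixGroups

open CongruenceSubgroup Matrix.SpecialLinearGroup ModularGroup
open Literature.NumberTheory.EllipticCurves.ModularForms

namespace Summit.BirchSwinnertonDyer.BirchSwinnertonDyer.Theorems.ThetaLayerLambdaCongruenceAtTwo

section CuspFn

/-- A cusp function is invariant under right multiplication by any power of `T`. [folklore] -/
theorem cuspFn_mul_T_zpow {A : Type} [AddCommGroup A] (F : SL(2, ℤ) → A) (hT : ∀ g, F (g * T) = F g) (g : SL(2, ℤ)) (k : ℤ) :
    F (g * T ^ k) = F g := by
  have hTk : ∀ (k : ℕ) (g : SL(2, ℤ)), F (g * T ^ k) = F g := by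
    intro k; induction k with
    | zero => intro g; simp
    | succ k ih => intro g; rw [pow_succ, ← mul_assoc, hT, ih]
  rcases Int.eq_nat_or_neg k with ⟨n, rfl | rfl⟩
  · exact_mod_cast hTk n g
  · have h := hTk n (g * T ^ (-(n : ℤ)))
    rw [mul_assoc, ← zpow_natCast, ← zpow_add, neg_add_cancel, zpow_zero, mul_one] at h
    exact h.symm

/-- **Primitive vectors**: if the first columns of `h, h' ∈ SL₂(ℤ)` are proportional (`k·col₀(h) = k'·col₀(h')`, `k, k' ≠ 0`) then they
are equal up to sign. [folklore] -/
theorem col_eq_or_eq_neg_of_smul_eq (h h' : SL(2, ℤ)) (k k' : ℤ) (hk' : k' ≠ 0)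
    (h0 : k * h 0 0 = k' * h' 0 0) (h1 : k * h 1 0 = k' * h' 1 0) :
    (h' 0 0 = h 0 0 ∧ h' 1 0 = h 1 0) ∨ (h' 0 0 = -h 0 0 ∧ h' 1 0 = -h 1 0) := by
  have hd : h 0 0 * h 1 1 - h 0 1 * h 1 0 = 1 := by
    have := Matrix.det_fin_two h.1; rw [h.2] at this; linear_combination -this
  have hd' : h' 0 0 * h' 1 1 - h' 0 1 * h' 1 0 = 1 := by
    have := Matrix.det_fin_two h'.1; rw [h'.2] at this; linear_combination -this
  -- `k' (h'₀₀ h₁₁ − h'₁₀ h₀₁) = k` and symmetrically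
  have e1 : k' * (h' 0 0 * h 1 1 - h' 1 0 * h 0 1) = k := by linear_combination h 1 1 * (-h0) + h 0 1 * h1 + k * hd
  have e2 : k * (h 0 0 * h' 1 1 - h 1 0 * h' 0 1) = k' := by linear_combination h' 1 1 * h0 - h' 0 1 * h1 + k' * hd'
  have hdvd : k' ∣ k := ⟨_, e1.symm⟩
  have hdvd' : k ∣ k' := ⟨_, e2.symm⟩
  rcases Int.natAbs_eq_natAbs_iff.mp (Int.natAbs_eq_of_dvd_dvd hdvd' hdvd) with e | e
  · left
    rw [e] at h0 h1
    exact ⟨(mul_left_cancel₀ hk' h0).symm, (mul_left_cancel₀ hk' h1).symm⟩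
  · right
    rw [e] at h0 h1
    constructor
    · have : k' * h' 0 0 = k' * (-h 0 0) := by linear_combination -h0
      exact mul_left_cancel₀ hk' this
    · have : k' * h' 1 0 = k' * (-h 1 0) := by linear_combination -h1
      exact mul_left_cancel₀ hk' this

/-- **Cusp functions depend only on the cusp**: if the first columns of `h, h'` are proportional then `F h = F h'` for every cusp
function `F`. [cite: Manin1972, §1.5] -/
theorem cuspFn_eq_of_col_smul_eq {A : Type} [AddCommGroup A] (F : SL(2, ℤ) → A) (hT : ∀ g, F (g * T) = F g)
    (hneg : ∀ g, F (-g) = F g) (h h' : SL(2, ℤ)) (k k' : ℤ) (hk' : k' ≠ 0)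
    (h0 : k * h 0 0 = k' * h' 0 0) (h1 : k * h 1 0 = k' * h' 1 0) : F h' = F h := by
  rcases col_eq_or_eq_neg_of_smul_eq h h' k k' hk' h0 h1 with ⟨e0, e1⟩ | ⟨e0, e1⟩
  · obtain ⟨j, rfl⟩ := exists_eq_mul_T_zpow_of_col_eq h h' e0 e1
    exact cuspFn_mul_T_zpow F hT h j
  · have e0' : (-h') 0 0 = h 0 0 := by simp [e0]
    have e1' : (-h') 1 0 = h 1 0 := by simp [e1]
    obtain ⟨j, hj⟩ := exists_eq_mul_T_zpow_of_col_eq h (-h') e0' e1'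
    rw [← hneg h', hj]
    exact cuspFn_mul_T_zpow F hT h j

end CuspFn

section ManinChain

variable {N : ℕ}

/-- Sum over a concatenation of lists. [folklore] -/
theorem list_sum_map_flatMap {β : Type} [AddCommMonoid β] (L : List SL(2, ℤ)) (Q : SL(2, ℤ) → List SL(2, ℤ)) (φ : SL(2, ℤ) → β) :
    ((L.flatMap Q).map φ).sum = (L.map fun g ↦ ((Q g).map φ).sum).sum := by
  induction L with
  | nil => simp
  | cons a L ih => simp [List.flatMap_cons, ih]

/-- **Manin chains of the cocycle by concatenated re-expansions (brick HA7).** Let `M, M'` be integer matrices with `M₁₀ = M'₁₀ = 0` and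
positive determinant, `δ ∈ Γ₀(N)` with `M·γ' = δ·M'`, and `L` a Manin chain of `γ'`. Suppose for every `g ∈ SL₂(ℤ)` we are given the
re-expansion data of the generalised edge `C_g = M·g·S` (frame `g₀(g)`, list `P_g`, end frame `h₁(g)`, as in `exists_reexpansion`:
`g₀(g)·P_g` telescopes from `F(g₀(g))` to `F(g₀(g)h₁(g))`, `col₀(C_g) = u_g·col₀(g₀(g))`, `col₁(C_g) = d_g·col₀(g₀(g)h₁(g))`). Then
`L' = concat_{g∈L} [g₀(g)·f·S : f ∈ P_g]` is a Manin chain of `δ`: `Σ_{x∈L'} F(x) − F(xS) = F(δ) − F(1)` for every cusp function `F`.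
[cite: Manin1972, §1.5–1.7] [cite: Merel1995Homologie, §2.1] -/
theorem maninChain_of_reexpansions (M M' : Matrix (Fin 2) (Fin 2) ℤ) (hM : M 1 0 = 0) (hM' : M' 1 0 = 0)
    (hMdet : 0 < M.det) (γ' δ : Gamma0 N)
    (hcoc : M * ((γ' : SL(2, ℤ)) : Matrix (Fin 2) (Fin 2) ℤ) = ((δ : SL(2, ℤ)) : Matrix (Fin 2) (Fin 2) ℤ) * M')
    (L : List SL(2, ℤ))
    (hL : ∀ {A : Type} [AddCommGroup A] (F : SL(2, ℤ) → A), (∀ g, F (g * T) = F g) → (∀ g, F (-g) = F g) →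
      (L.map fun g ↦ F g - F (g * S)).sum = F (γ' : SL(2, ℤ)) - F 1)
    (g₀ h₁ : SL(2, ℤ) → SL(2, ℤ)) (P : SL(2, ℤ) → List SL(2, ℤ)) (uu dd : SL(2, ℤ) → ℤ)
    (huu : ∀ g, uu g ≠ 0) (hdd : ∀ g, dd g ≠ 0)
    (htel : ∀ g, ∀ {A : Type} [AddCommGroup A] (F : SL(2, ℤ) → A), (∀ g, F (g * T) = F g) → (∀ g, F (-g) = F g) →
      (((P g).map fun f ↦ g₀ g * f).map fun f ↦ F (f * S) - F f).sum = F (g₀ g * h₁ g) - F (g₀ g))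
    (hcol0 : ∀ g i, (M * ((g : SL(2, ℤ)) : Matrix (Fin 2) (Fin 2) ℤ) * ((S : SL(2, ℤ)) : Matrix (Fin 2) (Fin 2) ℤ)) i 0 =
      uu g * (g₀ g) i 0)
    (hcol1 : ∀ g i, (M * ((g : SL(2, ℤ)) : Matrix (Fin 2) (Fin 2) ℤ) * ((S : SL(2, ℤ)) : Matrix (Fin 2) (Fin 2) ℤ)) i 1 =
      dd g * (g₀ g * h₁ g) i 0)
    {A : Type} [AddCommGroup A] (F : SL(2, ℤ) → A) (hT : ∀ g, F (g * T) = F g) (hneg : ∀ g, F (-g) = F g) :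
    ((L.flatMap fun g ↦ (P g).map fun f ↦ g₀ g * f * S).map fun x ↦ F x - F (x * S)).sum = F (δ : SL(2, ℤ)) - F 1 := by
  -- a frame `θ k` at the cusp `M k ∞` for every `k`
  have hθ : ∀ k : SL(2, ℤ), ∃ (θ : SL(2, ℤ)) (c : ℤ), c ≠ 0 ∧ ∀ i, (M * ((k : SL(2, ℤ)) : Matrix (Fin 2) (Fin 2) ℤ)) i 0 = c * θ i 0 := by
    intro k
    have hdet : 0 < (M * ((k : SL(2, ℤ)) : Matrix (Fin 2) (Fin 2) ℤ)).det := by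
      rw [Matrix.det_mul, Matrix.SpecialLinearGroup.det_coe, mul_one]; exact hMdet
    obtain ⟨θ, u, v, w, hu, -, hkeq⟩ := exists_hermite _ hdet
    refine ⟨θ, u, hu.ne', fun i ↦ ?_⟩
    rw [hkeq, Matrix.mul_apply, Fin.sum_univ_two]
    fin_cases i <;> simp <;> ring
  choose θ c hc hθc using hθ
  -- the cusp function `F̂ k = F (θ k)`
  have hMk0 : ∀ (k : SL(2, ℤ)) i, (M * ((k : SL(2, ℤ)) : Matrix (Fin 2) (Fin 2) ℤ)) i 0 = M i 0 * k 0 0 + M i 1 * k 1 0 := by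
    intro k i; rw [Matrix.mul_apply, Fin.sum_univ_two]
  have FhatT : ∀ k, F (θ (k * T)) = F (θ k) := by
    intro k
    refine cuspFn_eq_of_col_smul_eq F hT hneg (θ k) (θ (k * T)) (c k) (c (k * T)) (hc (k * T)) ?_ ?_
    · rw [← hθc, ← hθc, hMk0, hMk0]; simp [ModularGroup.coe_T, Matrix.mul_apply, Fin.sum_univ_two]
    · rw [← hθc, ← hθc, hMk0, hMk0]; simp [ModularGroup.coe_T, Matrix.mul_apply, Fin.sum_univ_two]
  have Fhatneg : ∀ k, F (θ (-k)) = F (θ k) := by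
    intro k
    refine cuspFn_eq_of_col_smul_eq F hT hneg (θ k) (θ (-k)) (-c k) (c (-k)) (hc (-k)) ?_ ?_
    · rw [← hθc, neg_mul, ← hθc, hMk0, hMk0]; simp; ring
    · rw [← hθc, neg_mul, ← hθc, hMk0, hMk0]; simp; ring
  -- telescoping of `L` for `F̂`
  have hLhat := hL (fun k ↦ F (θ k)) FhatT Fhatneg
  -- endpoints: `F̂ 1 = F 1`, `F̂ γ' = F δ`
  have h_one : F (θ 1) = F 1 := by
    refine cuspFn_eq_of_col_smul_eq F hT hneg 1 (θ 1) (M 0 0) (c 1) (hc 1) ?_ ?_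
    · rw [← hθc, hMk0]; simp
    · rw [← hθc, hMk0]; simp [hM]
  have h_gam : F (θ (γ' : SL(2, ℤ))) = F (δ : SL(2, ℤ)) := by
    refine cuspFn_eq_of_col_smul_eq F hT hneg (δ : SL(2, ℤ)) (θ (γ' : SL(2, ℤ))) (M' 0 0) (c (γ' : SL(2, ℤ))) (hc _) ?_ ?_
    · rw [← hθc, hcoc, Matrix.mul_apply, Fin.sum_univ_two, hM']; simp; ring
    · rw [← hθc, hcoc, Matrix.mul_apply, Fin.sum_univ_two, hM']; simp; ring
  -- each block telescopes from `F̂ (gS)`… more precisely from `F(g₀ g)` (cusp `MgS∞ = Mg0`) to `F(g₀ g h₁ g)` (cusp `Mg∞`)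
  have hS0 : ∀ (g : SL(2, ℤ)) i, (M * ((g : SL(2, ℤ)) : Matrix (Fin 2) (Fin 2) ℤ) * ((S : SL(2, ℤ)) : Matrix (Fin 2) (Fin 2) ℤ)) i 0 =
      (M * (((g * S : SL(2, ℤ))) : Matrix (Fin 2) (Fin 2) ℤ)) i 0 := by
    intro g i; rw [Matrix.SpecialLinearGroup.coe_mul, Matrix.mul_assoc]
  have hS1 : ∀ (g : SL(2, ℤ)) i, (M * ((g : SL(2, ℤ)) : Matrix (Fin 2) (Fin 2) ℤ) * ((S : SL(2, ℤ)) : Matrix (Fin 2) (Fin 2) ℤ)) i 1 =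
      -(M * ((g : SL(2, ℤ)) : Matrix (Fin 2) (Fin 2) ℤ)) i 0 := by
    intro g i
    rw [Matrix.mul_assoc, Matrix.mul_apply, Fin.sum_univ_two, Matrix.mul_apply, Fin.sum_univ_two, ModularGroup.coe_S]
    simp [Matrix.mul_apply, Fin.sum_univ_two]; ring
  have hstart : ∀ g, F (g₀ g) = F (θ (g * S)) := by
    intro g
    refine (cuspFn_eq_of_col_smul_eq F hT hneg (θ (g * S)) (g₀ g) (c (g * S)) (uu g) (huu g) ?_ ?_)
    · rw [← hθc, ← hS0, hcol0]
    · rw [← hθc, ← hS0, hcol0]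
  have hend : ∀ g, F (g₀ g * h₁ g) = F (θ g) := by
    intro g
    refine (cuspFn_eq_of_col_smul_eq F hT hneg (θ g) (g₀ g * h₁ g) (-c g) (dd g) (hdd g) ?_ ?_)
    · rw [neg_mul, ← hθc, ← hS1, hcol1]
    · rw [neg_mul, ← hθc, ← hS1, hcol1]
  -- assemble
  rw [list_sum_map_flatMap]
  have hblock : ∀ g, (((P g).map fun f ↦ g₀ g * f * S).map fun x ↦ F x - F (x * S)).sum = F (θ g) - F (θ (g * S)) := by
    intro g
    have h := htel g F hT hneg
    rw [List.map_map] at h ⊢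
    have e : ((P g).map ((fun x ↦ F x - F (x * S)) ∘ fun f ↦ g₀ g * f * S)) =
        (P g).map ((fun f ↦ F (f * S) - F f) ∘ fun f ↦ g₀ g * f) := by
      refine List.map_congr_left fun f _ ↦ ?_
      simp only [Function.comp_apply, mul_assoc, S_mul_S_eq_neg_one, mul_neg, mul_one, hneg]
    rw [e, h, hend, hstart]
  simp_rw [hblock]
  rw [hLhat, h_one, h_gam]

end ManinChain

end Summit.BirchSwinnertonDyer.BirchSwinnertonDyer.Theorems.ThetaLayerLambdaCongruenceAtTwo

end
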